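import Summits.QuantumFields.YangMills.Theorems.LuscherReductionRunningReductionOneSiteTailCount
import Summits.QuantumFields.YangMills.Theorems.LuscherReductionRunningReductionOneSiteTailOuter
import Summits.QuantumFields.YangMills.Theorems.LuscherReductionOneSiteLevelsAbsLower
import Literature.Analysis.OperatorTheory.YangMillsMatrixModelAL1Holds

/-!
# Crux RED `RunningReduction`, line «KTR» PART 8 — stub `TT.stub_oneSiteTail` / item `OneSiteTail` (stmt-QuantumFields-20204), tool 7:
# the B-UNIFORM WINDOW FLOOR — `physLevel (k+1) > 16E + C₀ ⟹ λ_k(B) ≤ e^{−λ_b E} λ_0(B)` for `E λ_b ≤ B^{−1/4}/8000`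

Support module for crux `RunningReduction` (route `LuscherReduction`, item stmt-QuantumFields-19978), registered stub
`TT.stub_oneSiteTail` (KTR PART 8; plan of record = ym-cruxidea-19978-2 g10's STUB-READING §2 S2), fleet base ym-luscher-20007-p1 (gen 4).

The thresholds of tools 2–6 made explicit.  Inputs: the k-uniform OUTER gain `γ_B = B^{−1/4}/4000` (`outer_uniform`), the quasimode floor
`λ_0(B) ≥ linkC³ e^{−E₀λ_b − C_Lλ_b²}` (`oneSiteAbsLower_of_eigenfunctions` at `k = 0` with the tree theorem `LuscherHamiltonianEigenfunctions_holds 0`),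
and `E'·λ_b ≤ c·B^{−1/4}` eventually (`mul_bareLambda_le_gain`).  Output (`window_floor`):

  `∃ B0 C₀, ∀ B ≥ B0, ∀ E ≥ 0 with E·λ_b ≤ B^{−1/4}/8000, ∀ k, 16E + C₀ < physLevel (k+1) → λ_k(B) ≤ e^{−Eλ_b} λ_0(B)`,

i.e. a B-UNIFORM upper bound `λ_k/λ_0 ≤ exp(−λ_b (E_k − C₀)/16)` for all levels with `E_k = physLevel (k+1)` in the window `≲ B^{1/12}`
— the «polynomial Weyl count in the femto window» behind `OneSiteTail`.  `window_arith` is the pure real arithmetic of the thresholds.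

HONEST FRAMING: one-site (`L = 1`) three-matrix `SU(2)` model, femto rung R2b1; the constants `16`, `C₀` are crude by design (only polynomial
counting is at stake); nothing here is infinite volume, a mass gap or Clay.  Sorry-free, no new definitions, no named-fact hypotheses.
-/

set_option autoImplicit false

noncomputable section

open MeasureTheory Filter Topology Real
open scoped ENNReal BigOperators
open Literature.MathematicalPhysics.QuantumFieldTheory
open Literature.MathematicalPhysics.QuantumLattice
open Literature.Analysis.OperatorTheory.YMMatrixModel

namespace Summit.QuantumFields.YangMills.Theorems.FemtoTransferGap.OST

open Summit.QuantumFields.YangMills.Theorems.FemtoTransferGap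

/-! ### §1. The real arithmetic of the window -/

/-- `1 − y ≤ e^{−y}`. [folklore] -/
theorem one_sub_le_exp_neg' (y : ℝ) : 1 - y ≤ Real.exp (-y) := by
  linarith [Real.add_one_le_exp (-y)]
set_option maxHeartbeats 400000 in
/-- **Window arithmetic.**  With `μ = e^{−Et}·λ₀`, `λ₀ ≥ L e^{−E₀t − C_L t²}`, `λ₀ ≤ L`, `E t ≤ γ/2`, `E₀t + |C_L|t² + Dt² ≤ γ/4`,
`0 < γ ≤ 1/4000`, `0 < t ≤ 1/600`: `μ ≤ L`, the injection window `L(1 − γ + Dt²) < μ` holds, `4a′ + 2t² ≤ 1/2` and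
`2(4a′/t + 4706) ≤ 16E + 16(E₀ + |C_L| + D) + 9412`, where `a′ = L/(μ − L·Dt²) − 1`. [folklore] -/
theorem window_arith {L t γ E E0 CL D lam0 : ℝ} (hL : 0 < L) (ht : 0 < t) (ht600 : t ≤ 1 / 600) (hγ0 : 0 < γ)
    (hγ1 : γ ≤ 1 / 4000) (hD : 0 ≤ D) (hE : 0 ≤ E) (hE0 : 0 ≤ E0) (hwinE : E * t ≤ γ / 2)
    (hrest : E0 * t + |CL| * t ^ 2 + D * t ^ 2 ≤ γ / 4) (hlam0 : L * Real.exp (-(E0 * t) - CL * t ^ 2) ≤ lam0)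
    (hlam0L : lam0 ≤ L) :
    Real.exp (-(E * t)) * lam0 ≤ L ∧
    L * (1 - γ + D * t ^ 2) < Real.exp (-(E * t)) * lam0 ∧
    4 * (L / (Real.exp (-(E * t)) * lam0 - L * (D * t ^ 2)) - 1) + 2 * t ^ 2 ≤ 1 / 2 ∧
    2 * (4 * (L / (Real.exp (-(E * t)) * lam0 - L * (D * t ^ 2)) - 1) / t + 4706) ≤ 16 * E + (16 * (E0 + |CL| + D) + 9412) := by
  set μ : ℝ := Real.exp (-(E * t)) * lam0 with hμ
  set y : ℝ := E * t + E0 * t + |CL| * t ^ 2 with hy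
  set x : ℝ := y + D * t ^ 2 with hx
  have ht2 : 0 ≤ t ^ 2 := sq_nonneg t
  have hy0 : 0 ≤ y := by rw [hy]; positivity
  have hx0 : 0 ≤ x := by rw [hx]; positivity
  have hxγ : x < γ := by rw [hx, hy]; linarith
  have hx1 : x ≤ 1 / 2 := by linarith
  -- `μ ≥ L (1 − y)`
  have hexp1 : Real.exp (-(E * t)) ≤ 1 := Real.exp_le_one_iff.mpr (by nlinarith)
  have hexp0 : 0 < Real.exp (-(E * t)) := Real.exp_pos _
  have hμlow : L * (1 - y) ≤ μ := by
    have h1 : L * Real.exp (-y) ≤ μ := by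
      have h2 : Real.exp (-(E * t)) * (L * Real.exp (-(E0 * t) - CL * t ^ 2)) ≤ μ :=
        mul_le_mul_of_nonneg_left hlam0 hexp0.le
      have h3 : L * Real.exp (-y) ≤ Real.exp (-(E * t)) * (L * Real.exp (-(E0 * t) - CL * t ^ 2)) := by
        have e1 : Real.exp (-(E * t)) * (L * Real.exp (-(E0 * t) - CL * t ^ 2)) = L * Real.exp (-(E * t) + (-(E0 * t) - CL * t ^ 2)) := by
          rw [Real.exp_add]; ring
        rw [e1]
        refine mul_le_mul_of_nonneg_left (Real.exp_le_exp.mpr ?_) hL.le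
        rw [hy]
        have : CL * t ^ 2 ≤ |CL| * t ^ 2 := mul_le_mul_of_nonneg_right (le_abs_self _) ht2
        linarith
      exact h3.trans h2
    have h4 : L * (1 - y) ≤ L * Real.exp (-y) := mul_le_mul_of_nonneg_left (one_sub_le_exp_neg' y) hL.le
    exact h4.trans h1
  have hlam00 : 0 ≤ lam0 := le_trans (by positivity) hlam0
  have c1 : μ ≤ L := by
    calc μ = Real.exp (-(E * t)) * lam0 := rfl
      _ ≤ 1 * L := mul_le_mul hexp1 hlam0L hlam00 zero_le_one
      _ = L := one_mul L
  have c2 : L * (1 - γ + D * t ^ 2) < μ := by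
    have : L * (1 - γ + D * t ^ 2) < L * (1 - y) := by
      refine mul_lt_mul_of_pos_left ?_ hL
      rw [hx] at hxγ; linarith
    exact this.trans_le hμlow
  -- `ν ≥ L(1 − x) > 0` and `a′ ≤ 2x`
  set ν : ℝ := μ - L * (D * t ^ 2) with hν
  have hνlow : L * (1 - x) ≤ ν := by rw [hν, hx]; linarith
  have h1x : 0 < 1 - x := by linarith
  have hν0 : 0 < ν := lt_of_lt_of_le (mul_pos hL h1x) hνlow
  have ha' : L / ν - 1 ≤ 2 * x := by
    have h1 : L / ν ≤ 1 / (1 - x) := by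
      rw [div_le_div_iff₀ hν0 h1x]; linarith
    have h2 : 1 / (1 - x) - 1 ≤ 2 * x := by
      rw [div_sub_one h1x.ne', div_le_iff₀ h1x]
      nlinarith
    linarith
  have ha'0 : 0 ≤ L / ν - 1 := by
    rw [sub_nonneg, le_div_iff₀ hν0, one_mul, hν]
    nlinarith [mul_nonneg hL.le (mul_nonneg hD ht2)]
  refine ⟨c1, c2, ?_, ?_⟩
  · have : t ^ 2 ≤ 1 / 600 * (1 / 600) := by nlinarith
    linarith
  · have h1 : 4 * (L / ν - 1) / t ≤ 8 * x / t := by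
      exact div_le_div_of_nonneg_right (by linarith) ht.le
    have h2 : 8 * x / t = 8 * (E + E0 + |CL| * t + D * t) := by
      rw [hx, hy]; field_simp
    have h3 : |CL| * t ≤ |CL| := by nlinarith [abs_nonneg CL]
    have h4 : D * t ≤ D := by nlinarith
    have h5 : 4 * (L / ν - 1) / t ≤ 8 * (E + E0 + |CL| + D) := by rw [h2] at h1; linarith
    linarith

/-! ### §2. The window floor -/

/-- `λ_0(B) ≤ linkCE B` (`B ≥ 0`): the Schur bound in `levelValue` form. [folklore] -/
theorem levelValue_zero_le_linkCE {B : ℝ} (hB : 0 ≤ B) : levelValue su2Rep 1 B 0 ≤ linkCE B :=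
  levelValue_zero_le_of_forall_rayleigh_le su2Rep B (linkCE_pos hB).le fun _ hψ _ => qform_le_linkCE_mul_l2 hB hψ

/-- **THE B-UNIFORM WINDOW FLOOR.**  There are `B0` and `C₀` such that for all `B ≥ B0`, all `E ≥ 0` with `E·λ_b(B) ≤ B^{−1/4}/8000` and all
levels `k` with `16E + C₀ < physLevel (k+1)`:  `λ_k(B) ≤ e^{−E λ_b(B)} · λ_0(B)`.  (The level COUNT below femto energy `E`, uniformly in `B`,
is at most the number of invariant levels of Lüscher's `𝔥` below `16E + C₀`.) [cite: SimonB1983DiscreteSpectrum, §3, Cor. 4] [cite: Luscher1983, §2–§3] -/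
theorem window_floor : ∃ B0 C₀ : ℝ, ∀ B : ℝ, B0 ≤ B → ∀ E : ℝ, 0 ≤ E → E * bareLambda B ≤ 1 / 8000 * B ^ (-(1 / 4 : ℝ)) →
    ∀ k : ℕ, 16 * E + C₀ < physLevel (k + 1) →
      levelValue su2Rep 1 B k ≤ Real.exp (-(E * bareLambda B)) * levelValue su2Rep 1 B 0 := by
  obtain ⟨B₂, hB₂2, hout⟩ := outer_uniform
  obtain ⟨CL, BL, hlow⟩ := oneSiteAbsLower_of_eigenfunctions (LuscherHamiltonianEigenfunctions_holds 0)
  set D : ℝ := 9 / 4 * (Real.pi ^ 2 / 4) * cM2 with hD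
  have hD0 : 0 ≤ D := by rw [hD]; have := cM2_pos; positivity
  have hE0 : 0 ≤ physLevel 1 := physLevel_nonneg le_rfl
  obtain ⟨T, hT1, hT⟩ := mul_bareLambda_le_gain (c₀ := 1 / 16000) (a := 1 / 4) (by norm_num) (by norm_num) (physLevel 1 + |CL| + D)
  -- `λ_b ≤ 1/600` for `B ≥ 2·600³`
  refine ⟨max (max (max B₂ BL) T) (2 / (1 / 600) ^ 3), 16 * (physLevel 1 + |CL| + D) + 9412, fun B hB E hE hEw k hk => ?_⟩
  have hBB₂ : B₂ ≤ B := (((le_max_left _ _).trans (le_max_left _ _)).trans (le_max_left _ _)).trans hB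
  have hBBL : BL ≤ B := (((le_max_right _ _).trans (le_max_left _ _)).trans (le_max_left _ _)).trans hB
  have hBT : T ≤ B := ((le_max_right _ _).trans (le_max_left _ _)).trans hB
  have hB600 : 2 / (1 / 600) ^ 3 ≤ B := (le_max_right _ _).trans hB
  have hB2 : 2 ≤ B := hB₂2.trans hBB₂
  have hB1 : 1 ≤ B := by linarith
  have hBpos : 0 < B := by linarith
  have ht : 0 < bareLambda B := bareLambda_pos' hBpos
  have ht600 : bareLambda B ≤ 1 / 600 := bareLambda_le_of_le (by norm_num) hB600
  have hL : 0 < linkCE B := linkCE_pos hBpos.le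
  have hCE : linkCE B = linkC B ^ 3 := by rw [linkCE, card_edge_one]
  set t := bareLambda B with htdef
  set γ : ℝ := 1 / 4000 * B ^ (-(1 / 4 : ℝ)) with hγ
  have hγ0 : 0 < γ := by rw [hγ]; positivity
  have hγ1 : γ ≤ 1 / 4000 := by
    rw [hγ]
    have : B ^ (-(1 / 4 : ℝ)) ≤ 1 := Real.rpow_le_one_of_one_le_of_nonpos hB1 (by norm_num)
    linarith
  have hγle1 : γ ≤ 1 := by linarith
  -- the arithmetic inputs
  have hwinE : E * t ≤ γ / 2 := by rw [hγ]; linarith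
  have hrest : physLevel 1 * t + |CL| * t ^ 2 + D * t ^ 2 ≤ γ / 4 := by
    have h1 := hT B hBT
    rw [← htdef] at h1
    have ht1 : t ≤ 1 := by linarith
    have htt : t ^ 2 ≤ t := by nlinarith
    have h2 : |CL| * t ^ 2 ≤ |CL| * t := mul_le_mul_of_nonneg_left htt (abs_nonneg CL)
    have h3 : D * t ^ 2 ≤ D * t := mul_le_mul_of_nonneg_left htt hD0
    have e : γ / 4 = 1 / 16000 * B ^ (-(1 / 4 : ℝ)) := by rw [hγ]; ring
    rw [e]
    nlinarith
  have hlam0 : linkCE B * Real.exp (-(physLevel 1 * t) - CL * t ^ 2) ≤ levelValue su2Rep 1 B 0 := by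
    have h := hlow B hBBL
    rw [← htdef, zero_add] at h
    rw [hCE]
    exact h
  have hlam0L : levelValue su2Rep 1 B 0 ≤ linkCE B := levelValue_zero_le_linkCE hBpos.le
  obtain ⟨c1, c2, c3, c4⟩ := window_arith hL ht ht600 hγ0 hγ1 hD0 hE hE0 hwinE hrest hlam0 hlam0L
  have hk' : 2 * (4 * (linkCE B / (Real.exp (-(E * t)) * levelValue su2Rep 1 B 0 - linkCE B * (D * t ^ 2)) - 1) / t + 4706)
      < physLevel (k + 1) := lt_of_le_of_lt c4 hk
  exact levelValue_le_of_physLevel_gt_at hB2 ht600 hγle1 (hout B hBB₂) c1 c2 c3 hk'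

end Summit.QuantumFields.YangMills.Theorems.FemtoTransferGap.OST

end
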